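import Literature.Analysis.FluidPDE.VorticityStretching
import Literature.Analysis.Calculus.HardyWholeSpace
import HarnessLib

/-!
# Hardy's inequality for vector fields on `ℝ³` with the Frobenius norm of the gradient

Analysis/FluidPDE support file (serves the "Hardy face" of the stretching-well binding form,
`StretchingRate.lean`, route `StretchingWellBinding` of `NavierStokesRegularity`).

For `ψ ∈ C¹_c(ℝ³; ℝ³)` and any centre `x₀ ∈ ℝ³` we prove

  `∫ |ψ(x)|²/|x − x₀|² dx ≤ 4 ∫ |∇ψ(x)|²_F dx`   (`integral_norm_sq_div_norm_sub_sq_le`),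

together with the integrability of the left integrand (`integrable_norm_sq_div_norm_sub_sq`),
where `|∇ψ|²_F = frobeniusNormSq (Dψ)` is the dissipation density of the tree
(`VectorCalculus.lean`). Proof: apply the scalar whole-space Hardy inequality
(`Calculus.hardy_sq_integral_sub_le`, constant `(2/(n−2))² = 4` for `n = 3`) to each component
`ψᵢ = eᵢ* ∘ ψ`, sum, and use `∑ᵢ ‖D ψᵢ‖² ≤ |Dψ|²_F` (`sum_sq_norm_proj_comp_le_frobeniusNormSq`,
Cauchy–Schwarz row by row). Small compact-support / positivity helpers used by
`StretchingRate.lean` are collected here as well (`hasCompactSupport_norm_sq`,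
`hasCompactSupport_frobeniusNormSq_fderiv`, `integral_norm_sq_pos_of_hasCompactSupport`).

## References

* Classical ("uncertainty principle lemma"); the scalar inequality and its provenance are in
  `Literature/Analysis/Calculus/HardyExterior.lean`, `HardyWholeSpace.lean`.
-/

noncomputable section

open MeasureTheory Set Function Filter
open scoped RealInnerProductSpace

namespace Literature.Analysis.FluidPDE

variable {ψ : EuclideanSpace ℝ (Fin 3) → EuclideanSpace ℝ (Fin 3)}

/-! ### Compact-support helpers -/

/-- The squared norm of a compactly supported field has compact support. [folklore] -/
theorem hasCompactSupport_norm_sq (hc : HasCompactSupport ψ) :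
    HasCompactSupport fun x => ‖ψ x‖ ^ 2 :=
  HasCompactSupport.intro hc fun _ hx => by simp [image_eq_zero_of_notMem_tsupport hx]

/-- The dissipation density of a compactly supported field has compact support. [folklore] -/
theorem hasCompactSupport_frobeniusNormSq_fderiv (hc : HasCompactSupport ψ) :
    HasCompactSupport fun x => frobeniusNormSq (fderiv ℝ ψ x) :=
  HasCompactSupport.intro hc fun _ hx => by simp [fderiv_of_notMem_tsupport ℝ hx]

/-- A continuous compactly supported field which is not identically zero has positive `L²` mass.
[folklore] -/
theorem integral_norm_sq_pos_of_hasCompactSupport (hψ : Continuous ψ)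
    (hc : HasCompactSupport ψ) (h0 : ψ ≠ 0) : 0 < ∫ x, ‖ψ x‖ ^ 2 := by
  obtain ⟨x, hx⟩ : ∃ x, ψ x ≠ 0 := by
    by_contra h
    push Not at h
    exact h0 (funext h)
  have hcont : Continuous fun y => ‖ψ y‖ ^ 2 := hψ.norm.pow 2
  have hx2 : ‖ψ x‖ ^ 2 ≠ 0 := pow_ne_zero 2 (norm_ne_zero_iff.2 hx)
  exact hcont.integral_pos_of_hasCompactSupport_nonneg_nonzero (hasCompactSupport_norm_sq hc)
    (fun y => sq_nonneg _) hx2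

/-! ### Components and the Frobenius norm -/

/-- Coordinate functionals versus the Frobenius norm: `∑ᵢ ‖eᵢ* ∘ L‖² ≤ |L|²_F` for a linear map
`L` of `ℝ³` (Cauchy–Schwarz row by row; in fact equality). [folklore] -/
theorem sum_sq_norm_proj_comp_le_frobeniusNormSq
    (L : EuclideanSpace ℝ (Fin 3) →L[ℝ] EuclideanSpace ℝ (Fin 3)) :
    ∑ i, ‖(EuclideanSpace.proj i).comp L‖ ^ 2 ≤ frobeniusNormSq L := by
  have hrow : ∀ i, ‖(EuclideanSpace.proj i).comp L‖ ^ 2 ≤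
      ∑ j, (L (EuclideanSpace.single j (1 : ℝ)) i) ^ 2 := by
    intro i
    set c : ℝ := Real.sqrt (∑ j, (L (EuclideanSpace.single j (1 : ℝ)) i) ^ 2) with hc
    have hc0 : 0 ≤ c := Real.sqrt_nonneg _
    have hop : ‖(EuclideanSpace.proj i).comp L‖ ≤ c := by
      refine ContinuousLinearMap.opNorm_le_bound _ hc0 fun w => ?_
      have hw : ((EuclideanSpace.proj i).comp L) w =
          ∑ j, w j * L (EuclideanSpace.single j 1) i := by
        rw [ContinuousLinearMap.comp_apply]
        exact clm_apply_coord L w i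
      have hcs := Finset.sum_mul_sq_le_sq_mul_sq Finset.univ (fun j => w j)
        fun j => L (EuclideanSpace.single j (1 : ℝ)) i
      have habs : |∑ j, w j * L (EuclideanSpace.single j 1) i| ≤
          Real.sqrt ((∑ j, w j ^ 2) * ∑ j, (L (EuclideanSpace.single j (1 : ℝ)) i) ^ 2) :=
        Real.abs_le_sqrt hcs
      have hnw : Real.sqrt (∑ j, w j ^ 2) = ‖w‖ := by
        rw [EuclideanSpace.norm_eq]
        congr 1
        exact Finset.sum_congr rfl fun j _ => by rw [Real.norm_eq_abs, sq_abs]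
      rw [hw, Real.norm_eq_abs]
      calc |∑ j, w j * L (EuclideanSpace.single j 1) i|
          ≤ Real.sqrt ((∑ j, w j ^ 2) * ∑ j, (L (EuclideanSpace.single j (1 : ℝ)) i) ^ 2) := habs
        _ = c * ‖w‖ := by
          rw [Real.sqrt_mul (Finset.sum_nonneg fun j _ => sq_nonneg _), hnw, hc, mul_comm]
    calc ‖(EuclideanSpace.proj i).comp L‖ ^ 2 ≤ c ^ 2 := by gcongr
      _ = ∑ j, (L (EuclideanSpace.single j (1 : ℝ)) i) ^ 2 :=
        Real.sq_sqrt (Finset.sum_nonneg fun j _ => sq_nonneg _)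
  calc ∑ i, ‖(EuclideanSpace.proj i).comp L‖ ^ 2
      ≤ ∑ i, ∑ j, (L (EuclideanSpace.single j (1 : ℝ)) i) ^ 2 :=
        Finset.sum_le_sum fun i _ => hrow i
    _ = ∑ j, ∑ i, (L (EuclideanSpace.single j (1 : ℝ)) i) ^ 2 := Finset.sum_comm
    _ = ∑ j, ‖L (EuclideanSpace.single j (1 : ℝ))‖ ^ 2 := by
      refine Finset.sum_congr rfl fun j _ => ?_
      rw [EuclideanSpace.norm_sq_eq]
      exact Finset.sum_congr rfl fun i _ => by rw [Real.norm_eq_abs, sq_abs]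
    _ = frobeniusNormSq L := by
      rw [frobeniusNormSq_eq_sum (EuclideanSpace.basisFun (Fin 3) ℝ)]
      simp [EuclideanSpace.basisFun_apply]

/-- Components of a `C¹` field: `D(ψᵢ)(x) = eᵢ* ∘ Dψ(x)`. [folklore] -/
theorem fderiv_coord_eq_proj_comp (hψ : ContDiff ℝ 1 ψ) (i : Fin 3)
    (x : EuclideanSpace ℝ (Fin 3)) :
    fderiv ℝ (fun y => ψ y i) x = (EuclideanSpace.proj i).comp (fderiv ℝ ψ x) := by
  have hd : HasFDerivAt ψ (fderiv ℝ ψ x) x := ((hψ.differentiable one_ne_zero) x).hasFDerivAt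
  exact ((EuclideanSpace.proj i).hasFDerivAt.comp x hd).fderiv

/-- Components of a compactly supported field have compact support. [folklore] -/
theorem hasCompactSupport_apply_coord (hc : HasCompactSupport ψ) (i : Fin 3) :
    HasCompactSupport fun x => ψ x i :=
  HasCompactSupport.intro hc fun _ hx => by simp [image_eq_zero_of_notMem_tsupport hx]

/-- … and so do the squared gradients of the components of a `C¹` field. [folklore] -/
theorem hasCompactSupport_norm_fderiv_coord_sq (hψ : ContDiff ℝ 1 ψ)
    (hc : HasCompactSupport ψ) (i : Fin 3) :
    HasCompactSupport fun x => ‖fderiv ℝ (fun y => ψ y i) x‖ ^ 2 :=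
  HasCompactSupport.intro hc fun _ hx => by
    simp [fderiv_coord_eq_proj_comp hψ, fderiv_of_notMem_tsupport ℝ hx]

/-- **Vector Hardy inequality on `ℝ³`, integrability**: for `ψ ∈ C¹_c(ℝ³; ℝ³)` and any centre
`x₀`, `x ↦ |ψ(x)|²/|x − x₀|²` is integrable. [folklore] -/
theorem integrable_norm_sq_div_norm_sub_sq (hψ : ContDiff ℝ 1 ψ)
    (hc : HasCompactSupport ψ) (x₀ : EuclideanSpace ℝ (Fin 3)) :
    Integrable fun x => ‖ψ x‖ ^ 2 / ‖x - x₀‖ ^ 2 := by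
  have hn : 3 ≤ Module.finrank ℝ (EuclideanSpace ℝ (Fin 3)) := by simp
  have hi : ∀ i, Integrable fun x => (ψ x i) ^ 2 / ‖x - x₀‖ ^ 2 := fun i =>
    Calculus.integrable_sq_div_norm_sub_sq (contDiff_euclidean.1 hψ i)
      (hasCompactSupport_apply_coord hc i) hn x₀
  have heq : (fun x => ‖ψ x‖ ^ 2 / ‖x - x₀‖ ^ 2) = fun x => ∑ i, (ψ x i) ^ 2 / ‖x - x₀‖ ^ 2 := by
    funext x
    rw [EuclideanSpace.norm_sq_eq, Finset.sum_div]
    exact Finset.sum_congr rfl fun i _ => by rw [Real.norm_eq_abs, sq_abs]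
  rw [heq]
  exact integrable_finsetSum _ fun i _ => hi i

/-- **Vector Hardy inequality on `ℝ³`** ("uncertainty principle lemma", sharp constant `4`): for
`ψ ∈ C¹_c(ℝ³; ℝ³)` and any centre `x₀`, `∫ |ψ(x)|²/|x − x₀|² dx ≤ 4 ∫ |∇ψ|²_F`
(componentwise from `Calculus.hardy_sq_integral_sub_le`, then `∑ᵢ ‖Dψᵢ‖² ≤ |Dψ|²_F`). [folklore] -/
theorem integral_norm_sq_div_norm_sub_sq_le (hψ : ContDiff ℝ 1 ψ)
    (hc : HasCompactSupport ψ) (x₀ : EuclideanSpace ℝ (Fin 3)) :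
    ∫ x, ‖ψ x‖ ^ 2 / ‖x - x₀‖ ^ 2 ≤ 4 * ∫ x, frobeniusNormSq (fderiv ℝ ψ x) := by
  have hn : 3 ≤ Module.finrank ℝ (EuclideanSpace ℝ (Fin 3)) := by simp
  have hC : (2 / ((Module.finrank ℝ (EuclideanSpace ℝ (Fin 3)) : ℝ) - 2)) ^ 2 = 4 := by
    rw [finrank_euclideanSpace_fin]
    norm_num
  have hci : ∀ i, ContDiff ℝ 1 fun x => ψ x i := fun i => contDiff_euclidean.1 hψ i
  have hcc : ∀ i, HasCompactSupport fun x => ψ x i := fun i => hasCompactSupport_apply_coord hc i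
  have hi : ∀ i, Integrable fun x => (ψ x i) ^ 2 / ‖x - x₀‖ ^ 2 := fun i =>
    Calculus.integrable_sq_div_norm_sub_sq (hci i) (hcc i) hn x₀
  -- Hardy for each component
  have hH : ∀ i, ∫ x, (ψ x i) ^ 2 / ‖x - x₀‖ ^ 2 ≤
      4 * ∫ x, ‖fderiv ℝ (fun y => ψ y i) x‖ ^ 2 := fun i => by
    have := Calculus.hardy_sq_integral_sub_le (hci i) (hcc i) hn x₀
    rwa [hC] at this
  -- integrability of the gradient terms
  have hDi : ∀ i, Integrable fun x => ‖fderiv ℝ (fun y => ψ y i) x‖ ^ 2 := fun i =>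
    (((hci i).continuous_fderiv one_ne_zero).norm.pow 2).integrable_of_hasCompactSupport
      (hasCompactSupport_norm_fderiv_coord_sq hψ hc i)
  have hFc : Continuous fun x => frobeniusNormSq (fderiv ℝ ψ x) := by
    simp only [frobeniusNormSq]
    exact continuous_finsetSum _ fun i _ =>
      (((hψ.continuous_fderiv one_ne_zero).clm_apply continuous_const).norm.pow 2)
  have hFi : Integrable fun x => frobeniusNormSq (fderiv ℝ ψ x) :=
    hFc.integrable_of_hasCompactSupport (hasCompactSupport_frobeniusNormSq_fderiv hc)
  -- pointwise: `∑ᵢ ‖Dψᵢ‖² ≤ |Dψ|²_F`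
  have hpt : ∀ x, ∑ i, ‖fderiv ℝ (fun y => ψ y i) x‖ ^ 2 ≤ frobeniusNormSq (fderiv ℝ ψ x) := by
    intro x
    simp_rw [fderiv_coord_eq_proj_comp hψ]
    exact sum_sq_norm_proj_comp_le_frobeniusNormSq _
  calc ∫ x, ‖ψ x‖ ^ 2 / ‖x - x₀‖ ^ 2 = ∫ x, ∑ i, (ψ x i) ^ 2 / ‖x - x₀‖ ^ 2 := by
        refine integral_congr_ae (ae_of_all _ fun x => ?_)
        dsimp only
        rw [EuclideanSpace.norm_sq_eq, Finset.sum_div]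
        exact Finset.sum_congr rfl fun i _ => by rw [Real.norm_eq_abs, sq_abs]
    _ = ∑ i, ∫ x, (ψ x i) ^ 2 / ‖x - x₀‖ ^ 2 := integral_finsetSum _ fun i _ => hi i
    _ ≤ ∑ i, 4 * ∫ x, ‖fderiv ℝ (fun y => ψ y i) x‖ ^ 2 := Finset.sum_le_sum fun i _ => hH i
    _ = 4 * ∫ x, ∑ i, ‖fderiv ℝ (fun y => ψ y i) x‖ ^ 2 := by
        rw [integral_finsetSum _ fun i _ => hDi i, Finset.mul_sum]
    _ ≤ 4 * ∫ x, frobeniusNormSq (fderiv ℝ ψ x) :=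
        mul_le_mul_of_nonneg_left
          (integral_mono (integrable_finsetSum _ fun i _ => hDi i) hFi hpt) (by norm_num)

end Literature.Analysis.FluidPDE

end
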